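import Summits.Ventures.HodgeRepro2.T5IsotypicDecomposition
import Summits.Ventures.HodgeRepro2.T5AbelianWeights

/-!
# Dimension bookkeeping of an irreducible decomposition: `dim V = ∑_{W ∈ S} dim W`

Blind cell `pub-hodge-repro2`, seat p1 (gen 12), Tier-5 kernel support (the counting sentences of
`route/T5-SUPPORT-p1.md` §S4.7: «each once», dimensions of K-types).

* `finrank_eq_sum_of_isInternal` — for a `Finset` internal direct sum `V = ⨁_{W ∈ S} W`,
  `dim V = ∑_{W ∈ S} dim W` (`T5IsotypicDecomposition.finrank_sup_eq_sum_of_supIndep`);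
* `card_le_finrank_of_isInternal` — the number of non-zero summands is at most `dim V`;
* `finrank_eq_sum_of_isInternal_irreducible` — for an irreducible decomposition of a continuous
  representation of a compact group (no unitarity), `dim V = ∑_{W ∈ S} dim W`, and for a compact
  ABELIAN group `dim V = #S` (`finrank_eq_card_of_isMulCommutative`).

Honest scope (unchanged): finite-dimensional representations; nothing about π₃⁺ or (N).
-/

namespace Summit.Ventures.HodgeRepro2.T5FinrankSum

open T5CompleteReducibility T5IsotypicCopies T5IsotypicDecomposition

variable {V : Type*} [NormedAddCommGroup V] [InnerProductSpace ℂ V] [FiniteDimensional ℂ V]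

/-- `dim V = ∑_{W ∈ S} dim W` for a `Finset` internal direct sum. -/
theorem finrank_eq_sum_of_isInternal (S : Finset (Submodule ℂ V))
    (hint : DirectSum.IsInternal (fam S)) :
    Module.finrank ℂ V = ∑ W ∈ S, Module.finrank ℂ W := by
  rw [← finrank_sup_eq_sum_of_supIndep S (supIndep_id_of_isInternal S hint)]
  have htop : S.sup id = ⊤ := by
    apply eq_top_iff.mpr
    rw [← hint.submodule_iSup_eq_top]
    exact iSup_le fun W => Finset.le_sup (f := id) W.2
  rw [htop, finrank_top]

/-- The number of non-zero summands of an internal direct sum is at most `dim V`. -/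
theorem card_le_finrank_of_isInternal (S : Finset (Submodule ℂ V))
    (hint : DirectSum.IsInternal (fam S)) (hne : ∀ W ∈ S, W ≠ ⊥) :
    S.card ≤ Module.finrank ℂ V := by
  rw [finrank_eq_sum_of_isInternal S hint]
  calc S.card = ∑ _W ∈ S, 1 := by simp
    _ ≤ ∑ W ∈ S, Module.finrank ℂ W :=
        Finset.sum_le_sum fun W hW => Submodule.one_le_finrank_iff.mpr (hne W hW)

variable {G : Type*} [Group G] (π : G →* V →L[ℂ] V)

/-- For an irreducible decomposition, `dim V = ∑_{W ∈ S} dim W` and the summands are non-zero. -/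
theorem finrank_eq_sum_of_isInternal_irreducible (S : Finset (Submodule ℂ V))
    (hint : DirectSum.IsInternal (fam S)) (hS : ∀ W ∈ S, IsIrreducibleSubspace π W) :
    Module.finrank ℂ V = ∑ W ∈ S, Module.finrank ℂ W ∧ S.card ≤ Module.finrank ℂ V :=
  ⟨finrank_eq_sum_of_isInternal S hint,
    card_le_finrank_of_isInternal S hint fun W hW => (hS W hW).1⟩

/-- For a COMMUTATIVE group every irreducible decomposition has exactly `dim V` summands (each a
line). -/
theorem finrank_eq_card_of_isMulCommutative [IsMulCommutative G] (S : Finset (Submodule ℂ V))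
    (hint : DirectSum.IsInternal (fam S)) (hS : ∀ W ∈ S, IsIrreducibleSubspace π W) :
    Module.finrank ℂ V = S.card := by
  rw [finrank_eq_sum_of_isInternal S hint]
  rw [Finset.sum_congr rfl fun W hW =>
    T5AbelianWeights.finrank_eq_one_of_isIrreducibleSubspace π (hS W hW)]
  simp

end Summit.Ventures.HodgeRepro2.T5FinrankSum
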